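import Literature.RingTheory.TightClosure.FrobeniusSplitting
import Mathlib.RingTheory.Localization.Module
import Mathlib.Algebra.Module.LocalizedModule.Basic
import HarnessLib

/-!
# The Frobenius push-forward commutes with localisation; `p^{-e}`-linear maps and F-splittings localise

Topic: `Literature/RingTheory/TightClosure`. For a localisation `S = M⁻¹R` of a ring `R` of
exponential characteristic `p`, the Frobenius push-forward `F^e_* S` (`FrobeniusPushforward.lean`)
is the localisation of the `R`-module `F^e_* R` at `M`, along the map induced by `R → S`
(`isLocalizedModule_pushAlgebraMap`): a fraction `a/s` is `s⁻¹ • (a s^{q-1})` for the twisted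
action (`q = p^e`), and `M` acts invertibly. Consequences, all PROVED:

* `exists_linearMap_localization` — every `R`-linear `φ : F^e_* R → R` (a `p^{-e}`-linear map)
  localises to an `S`-linear `φ' : F^e_* S → S` with `φ'(a/1) = φ(a)/1`
  (Mathlib `IsLocalizedModule.lift` + `LinearMap.extendScalarsOfIsLocalization`);
* `exists_split_localization` — F-splittings localise: if `φ(1) = 1` then `φ'(1) = 1`;
* `isFrobeniusClosed_localization_of_split` — hence in any localisation of an F-split ring every
  ideal is Frobenius closed (`isFrobeniusClosed_of_split`). In particular all local rings `R_P` of
  an F-split ring satisfy the Frobenius-closedness clause of F-injectivity for every ideal, with no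
  appeal to localisation theorems for F-injectivity.

What is NOT here: the scheme-theoretic version (stalks of a globally Frobenius-split scheme);
F-finiteness and flatness of `F^e_*` under localisation (`IsFFinite.of_isLocalization` is in
`Literature/AlgebraicGeometry/Resolution/FFinite.lean`).

## Sources

* [HochsterHuneke1989] M. Hochster, C. Huneke, *Tight closure and strong F-regularity*, Mém. Soc.
  Math. France 38 (1989), §3 (`Hom_R(R^{1/q}, R)` commutes with localisation).
* [Fedder1983] R. Fedder, *F-purity and rational singularity*, Trans. AMS 278 (1983) (F-purity is
  a local property).
-/

noncomputable section

namespace Literature.RingTheory.TightClosure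

open Literature.AlgebraicGeometry.Resolution

universe u v

namespace FrobeniusPushforward

variable {p e : ℕ} {R : Type u} [CommRing R] [ExpChar R p]

/-- **`F^e_* (M⁻¹R)` is the localisation of `F^e_* R` at `M`** (along the map induced by
`R → M⁻¹R`): `M` acts invertibly (`s • x = s^q x` and `s^q` is a unit), every `a/s` equals
`s⁻¹ • (a s^{q-1})/1`, and `a/1 = b/1` forces `c a = c b`, hence `c^q a = c^q b`, i.e.
`c • a = c • b`, for some `c ∈ M`. [cite: HochsterHuneke1989, §3; folklore] -/
theorem isLocalizedModule_pushAlgebraMap (M : Submonoid R) (S : Type v) [CommRing S] [Algebra R S]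
    [IsLocalization M S] [ExpChar S p] :
    IsLocalizedModule M
      (pushAlgebraMap (p := p) (e := e) S :
        FrobeniusPushforward p e R →ₗ[R] FrobeniusPushforward p e S) := by
  have hq : p ^ e ≠ 0 := pow_ne_zero e (expChar_ne_zero R p)
  refine ⟨fun s => ?_, fun y => ?_, fun {x₁ x₂} h => ?_⟩
  · -- `M` acts invertibly on `F^e_* S`
    obtain ⟨u, hu⟩ := IsLocalization.map_units S s
    have hsmul : ∀ x : FrobeniusPushforward p e S,
        (algebraMap R (Module.End R (FrobeniusPushforward p e S)) s) x =
          toPush ((u : S) ^ p ^ e) * x := fun x => by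
      rw [Module.algebraMap_end_apply, smul_def, hu]
    refine (Module.End.isUnit_iff _).mpr ⟨fun x y hxy => ?_, fun y => ?_⟩
    · rw [hsmul, hsmul] at hxy
      exact (IsUnit.mul_right_inj ((u.isUnit.pow _).map toPush)).mp hxy
    · refine ⟨toPush (((u⁻¹ : Sˣ) : S) ^ p ^ e) * y, ?_⟩
      rw [hsmul, ← mul_assoc, ← map_mul, ← mul_pow, Units.mul_inv, one_pow, map_one, one_mul]
  · -- every element is a fraction: `a/s = s⁻¹ • (a s^{q-1})/1`
    obtain ⟨y, rfl⟩ := (toPush (p := p) (e := e) (R := S)).surjective y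
    obtain ⟨⟨a, s⟩, has⟩ := IsLocalization.surj M y
    have has' : y * algebraMap R S s = algebraMap R S a := has
    refine ⟨⟨toPush (a * (s : R) ^ (p ^ e - 1)), s⟩, ?_⟩
    show s • (toPush y : FrobeniusPushforward p e S) =
      pushAlgebraMap S (toPush (a * (s : R) ^ (p ^ e - 1)))
    rw [Submonoid.smul_def, pushAlgebraMap_toPush, smul_def, ← map_mul]
    congr 1
    rw [map_mul, map_pow, ← has', mul_assoc, ← pow_succ',
      Nat.sub_add_cancel (Nat.one_le_iff_ne_zero.mpr hq), mul_comm]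
  · -- `a/1 = b/1 ⇒ c • a = c • b`
    obtain ⟨a, rfl⟩ := (toPush (p := p) (e := e) (R := R)).surjective x₁
    obtain ⟨b, rfl⟩ := (toPush (p := p) (e := e) (R := R)).surjective x₂
    rw [pushAlgebraMap_toPush, pushAlgebraMap_toPush] at h
    have h' : algebraMap R S a = algebraMap R S b := (toPush (p := p) (e := e) (R := S)).injective h
    obtain ⟨c, hc⟩ := IsLocalization.exists_of_eq (M := M) h'
    refine ⟨c, ?_⟩
    show c • (toPush a : FrobeniusPushforward p e R) = c • (toPush b : FrobeniusPushforward p e R)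
    rw [Submonoid.smul_def, Submonoid.smul_def, smul_toPush, smul_toPush, ← Nat.sub_add_cancel (Nat.one_le_iff_ne_zero.mpr hq), pow_succ,
      mul_assoc, hc, ← mul_assoc]

/-- **`p^{-e}`-linear maps localise**: every `R`-linear `φ : F^e_* R → R` induces an `S`-linear
`φ' : F^e_* S → S`, `S = M⁻¹R`, with `φ'(a/1) = φ(a)/1` (so `φ'(a/s^q) = φ(a)/s`).
[cite: HochsterHuneke1989, §3 (`Hom_R(R^{1/q}, R)_c = Hom_{R_c}(R_c^{1/q}, R_c)`); folklore] -/
theorem exists_linearMap_localization (M : Submonoid R) (S : Type v) [CommRing S] [Algebra R S]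
    [IsLocalization M S] [ExpChar S p]
    (φ : FrobeniusPushforward p e R →ₗ[R] R) :
    ∃ φ' : FrobeniusPushforward p e S →ₗ[S] S,
      ∀ r : R, φ' (toPush (algebraMap R S r)) = algebraMap R S (φ (toPush r)) := by
  haveI := isLocalizedModule_pushAlgebraMap (p := p) (e := e) M S
  let g : FrobeniusPushforward p e R →ₗ[R] S := Algebra.linearMap R S ∘ₗ φ
  have hunits : ∀ s : M, IsUnit (algebraMap R (Module.End R S) s) :=
    IsLocalizedModule.map_units (S := M) (f := Algebra.linearMap R S)
  let ψ : FrobeniusPushforward p e S →ₗ[R] S :=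
    IsLocalizedModule.lift M (pushAlgebraMap (p := p) (e := e) S) g hunits
  refine ⟨ψ.extendScalarsOfIsLocalization M S, fun r => ?_⟩
  show ψ (toPush (algebraMap R S r)) = _
  rw [← pushAlgebraMap_toPush, IsLocalizedModule.lift_apply]
  rfl

/-- **F-splittings localise**: if some `R`-linear `φ : F^e_* R → R` has `φ(1) = 1`, then some
`S`-linear `φ' : F^e_* S → S` has `φ'(1) = 1`, for every localisation `S` of `R` ("F-purity /
F-splitting is a local property", the easy direction). [cite: Fedder1983, §1; folklore] -/
theorem exists_split_localization (M : Submonoid R) (S : Type v) [CommRing S] [Algebra R S]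
    [IsLocalization M S] [ExpChar S p]
    (φ : FrobeniusPushforward p e R →ₗ[R] R) (hφ : φ (toPush 1) = 1) :
    ∃ φ' : FrobeniusPushforward p e S →ₗ[S] S, φ' (toPush 1) = 1 := by
  obtain ⟨φ', h⟩ := exists_linearMap_localization (p := p) (e := e) M S φ
  refine ⟨φ', ?_⟩
  have h1 := h 1
  rw [map_one (algebraMap R S), hφ, map_one (algebraMap R S)] at h1
  exact h1

/-- **In a localisation of an F-split ring every ideal is Frobenius closed**: combine
`exists_split_localization` with `isFrobeniusClosed_of_split`. So the local rings `R_P` of an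
F-split ring (`φ : F^e_* R → R`, `e ≥ 1`, `φ(1) = 1`) satisfy `x^q ∈ I^[q] ⇒ x ∈ I` for all ideals
`I` — the Frobenius-closedness clause of F-injectivity — at every prime `P`. [folklore] -/
theorem isFrobeniusClosed_localization_of_split (M : Submonoid R) (S : Type v) [CommRing S] [Algebra R S]
    [IsLocalization M S] [ExpChar S p] (he : 0 < e)
    (φ : FrobeniusPushforward p e R →ₗ[R] R) (hφ : φ (toPush 1) = 1) (I : Ideal S) :
    IsFrobeniusClosed p I := by
  obtain ⟨φ', hφ'⟩ := exists_split_localization (p := p) (e := e) M S φ hφ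
  exact isFrobeniusClosed_of_split he φ' hφ' I

end FrobeniusPushforward

end Literature.RingTheory.TightClosure

end
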